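import Mathlib
import HarnessLib
import HarnessLib.Audit
import Summits.CriticalPhenomena.Statement
import Literature.Probability.Percolation.BoxCrossing
import Literature.Probability.LatticeModels.CorrelationDecay

/-!
Route: AngleDoublingExponents

CLOSED (retired) 2026-08-15T13:47:44Z by operator:999:1257524 — reason: not-a-thesis: assembly does not conclude the sub-problem Statement — note: D-0027 §2.1 audit (human 2026-08-15: routes that do not decide the summit are removed): the assembly concludes `AngleDoublingLaw`, not the sub-problem statement; a NEW conforming route may be opened from the same idea (generated `closes : … → _root_.CardyFormulaZ2`).. The file is kept as the record of this route; refuted decls are indexed as negative knowledge (`ledger negatives`).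

# Route AngleDoublingExponents — Fold the lattice, halve the exponent — slit-tip two-arm 1/2, corner
two-arm 2 and the quadratic corner response as the cheapest conformal-not-scale statements on
bond-Z2, with a typed Cardy guard

FINGERPRINT ROUTE (corollary level plus typed refutation guard), realising card
angle-doubling-halves-exponents. Declared up front, exactly as for the barrier routes
QuarterTurnNoGo and SeamPivotalNoGo: X does NOT imply CardyFormulaZ2 and is not claimed to. The
implication runs the other way — CardyFormulaZ2 implies X (support CardyForcesCornerResponse types
its cheapest instance) — so a refutation of X, rigorous or numerical, is a typed kill criterion for
the conjunct and for every open Cardy route at once, while X itself is the cheapest statement about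
bond-ℤ² at p = 1/2 that scale-and-rotation invariance cannot predict and conformal covariance
predicts with rational numbers.
It suffices to show X = AngleDoublingLaw = SlitTipTwoArm ∧ CornerTwoArm ∧ CornerQuadraticResponse,
three mark-derivative statements about P_(1/2) crossing probabilities of explicit lattice domains,
typed over the tree's `openCrossing` / `rectangle` / `tbCrossing` / `HasDecayExponent` (no limit
objects, no LimitExists, no hypergeometric value):
(SlitTipTwoArm, wedge angle 2π) in the box {0..2n}² with the vertex row {(x,n) : x < n} removed,
adding the single tip vertex (n,n) to the target arc "lower lip of the slit" changes the probability
of an open crossing to the right side by n^(-1/2+o(1));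
(CornerTwoArm, angle π/2) removing the corner vertex (0,0) from the bottom arc of the square {0..n}²
changes the bottom–top crossing probability by n^(-2+o(1));
(CornerQuadraticResponse) moving that arc end a macroscopic fraction α of the side away from the
corner changes it by ≍ α² (C^(1,1)-flatness at a convex lattice corner).
The benchmark at a flat boundary point is 1/n (half-plane two-arm exponent 1, forced by the
mark-sweep identity Σ_x ΔP(x) ≤ 1; support SideTwoArmBenchmark), and lengthening the slit by its tip
vertex costs exactly order 1/n (slit-growth telescoping; support TipThreeArmForced). Cardy's wedge
law β_j(θ) = (π/θ)·β_j(π) (CardyEdge1983, CardyNPB1984, Cardy1996 Ex. 11.4), evaluated at the square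
lattice's own angles, turns the two forced half-plane exponents β₂(π) = 1, β₃(π) = 2 into the
predictions 1/2 (tip, two arms), 2 (corner, two arms) and 1 (tip, three arms — forced AND conformal,
the built-in sanity check): "doubling the angle halves the exponent", the fingerprint of z ↦ z²,
which ℤ² realises combinatorially by FOLDING (the slit box is two half-boxes glued along the ray
continuing the slit; the half-plane is two quadrants glued along a ray) — the engine the card
proposes for the cruxes.
Lean: `Literature.Probability.LatticeModels.HasDecayExponent (fun n : ℕ =>
(Literature.Probability.Percolation.bondPercolation (Literature.Probability.LatticeModels.zdGraph 2)
Literature.Probability.Percolation.half).real (Literature.Probability.Percolation.openCrossing {x :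
Literature.Probability.LatticeModels.Site 2 | x ∈ Literature.Probability.Percolation.rectangle (2 *
n) (2 * n) ∧ ¬ (x 1 = n ∧ x 0 < n)} {x | (x 1 = (n : ℤ) - 1 ∧ 0 ≤ x 0 ∧ x 0 ≤ n) ∨ x = ![(n : ℤ),
n]} ↑(Literature.Probability.Percolation.rightSide (2 * n) (2 * n))) -
(Literature.Probability.Percolation.bondPercolation (Literature.Probability.LatticeModels.zdGraph 2)
Literature.Probability.Percolation.half).real (Literature.Probability.Percolation.openCrossing {x :
Literature.Probability.LatticeModels.Site 2 | x ∈ Literature.Probability.Percolation.rectangle (2 *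
n) (2 * n) ∧ ¬ (x 1 = n ∧ x 0 < n)} {x | x 1 = (n : ℤ) - 1 ∧ 0 ≤ x 0 ∧ x 0 ≤ n}
↑(Literature.Probability.Percolation.rightSide (2 * n) (2 * n)))) (1 / 2) ∧
Literature.Probability.LatticeModels.HasDecayExponent (fun n : ℕ =>
(Literature.Probability.Percolation.bondPercolation (Literature.Probability.LatticeModels.zdGraph 2)
Literature.Probability.Percolation.half).real (Literature.Probability.Percolation.tbCrossing n n) -
(Literature.Probability.Percolation.bondPercolation (Literature.Probability.LatticeModels.zdGraph 2)
Literature.Probability.Percolation.half).real (Literature.Probability.Percolation.openCrossing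
↑(Literature.Probability.Percolation.rectangle n n) {x : Literature.Probability.LatticeModels.Site 2
| x 1 = 0 ∧ 1 ≤ x 0 ∧ x 0 ≤ n} ↑(Literature.Probability.Percolation.topSide n n))) 2 ∧ (∃ c C α₀ :
ℝ, 0 < c ∧ 0 < α₀ ∧ ∀ α : ℝ, 0 < α → α ≤ α₀ → ∀ᶠ n : ℕ in Filter.atTop, c * α ^ 2 ≤
(Literature.Probability.Percolation.bondPercolation (Literature.Probability.LatticeModels.zdGraph 2)
Literature.Probability.Percolation.half).real (Literature.Probability.Percolation.tbCrossing n n) -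
(Literature.Probability.Percolation.bondPercolation (Literature.Probability.LatticeModels.zdGraph 2)
Literature.Probability.Percolation.half).real (Literature.Probability.Percolation.openCrossing
↑(Literature.Probability.Percolation.rectangle n n) {x : Literature.Probability.LatticeModels.Site 2
| x 1 = 0 ∧ α * n ≤ ((x 0 : ℤ) : ℝ) ∧ x 0 ≤ n} ↑(Literature.Probability.Percolation.topSide n n)) ∧
(Literature.Probability.Percolation.bondPercolation (Literature.Probability.LatticeModels.zdGraph 2)
Literature.Probability.Percolation.half).real (Literature.Probability.Percolation.tbCrossing n n) -
(Literature.Probability.Percolation.bondPercolation (Literature.Probability.LatticeModels.zdGraph 2)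
Literature.Probability.Percolation.half).real (Literature.Probability.Percolation.openCrossing
↑(Literature.Probability.Percolation.rectangle n n) {x : Literature.Probability.LatticeModels.Site 2
| x 1 = 0 ∧ α * n ≤ ((x 0 : ℤ) : ℝ) ∧ x 0 ≤ n} ↑(Literature.Probability.Percolation.topSide n n)) ≤
C * α ^ 2)`

## Assembly
Pure logic (And.intro twice): the three cruxes are the three conjuncts of the target, in order.
Declared in § Thesis: this is a fingerprint / corollary route — the conclusion of the Assembly is
the target AngleDoublingLaw, not the conjunct; the implication CardyFormulaZ2 ⇒ X (support
CardyForcesCornerResponse and its foreseen exponent-level siblings) is what makes ¬X a typed kill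
criterion for CardyFormulaZ2.

Rationale: WHY THIS LINE. Every open route on this conjunct (CardyUniqueLimit, CardyRotToConf,
CardyExpCovariance, CardyCapacityWard, PivotalEnergyLaw, …) attacks full conformal covariance of
crossing limits; none isolates a statement that is at once (a) a theorem-sized consequence of
conformal covariance alone, (b) invisible to scale + rotation invariance (DKKMO2020Rotational gives
rotations of subsequential limits; dilations and Möbius maps are open, the moral of barrier
ScaleCovarianceNotMoebius), (c) typable today over the tree's bond-ℤ² crossing API and (d) decidable
by a short Monte-Carlo run. The wedge law of boundary conformal field theory — a boundary operator
of half-plane dimension x_s placed at the apex of a wedge of opening angle θ has dimension (π/θ)·x_s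
(CardyEdge1983; CardyNPB1984; the wedge-mapping exercise Cardy1996 Ex. 11.4, p. 198 of the held
copy); for percolation arms on the triangular lattice it follows from SmirnovWernerMRL2001 Thm 3
plus Smirnov2001, and nothing of it is proved on ℤ²) supplies exactly such statements at the two
angles π/2 and 2π that ℤ² realises exactly, and the card's forced-versus-genuine classification says
which of them test conformal covariance: an exponent is RSW-forced iff it is the density of a
one-parameter sweep identity (mark sweep ⇒ β₂(π) = 1, side push ⇒ β₃(π) = 2, slit growth ⇒ β₃(2π) =
1), and no sweep passes through a slit tip or a convex corner for two arms. Imported areas: boundary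
CFT / corner transfer matrices for the prediction; discrete potential theory as the PROVED linear
shadow on ℤ² itself (for simple random walk the harmonic measure of the tip of a lattice slit of
length n is ≍ n^(-1/2), with the per-site law s^(-1/2)·n^(-1/2) along the slit — Lawler1991
§2.4–2.5, eqs. (2.41)–(2.42) and Thm 2.5.2, the discrete Beurling estimate; KestenHitting1987 — and
≍ n^(-2) at a corner of a square: for random walk the halving IS the reflection principle);
Kesten–Nolin boundary-arm technology for the forced supports (Nolin2008 §4.6, WernerPCMI2009 first
exercise sheet, whose site-𝕋 version the tree has proved: real_hpGood_le_div, div_le_real_hpGood).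
The proposed engine for the cruxes is the card's fold / bilayer dictionary — W_(2θ) is two copies of
W_θ glued along a lattice ray, so a tip event is an event about two independent half-box
configurations interacting only through a seam, to be decorrelated by BK–Reimer across layers,
noise-sensitivity of one layer's arm events to the other (GarbanPeteSchramm2010) and Kesten's arm
separation at the seam (KestenScalingCMP1987); it is recorded as the line of attack and in the
two-layer plan, not as an item, because the dictionary alone is a redrawing with no content. What
the route delivers whatever the fate of the cruxes: typed, MC-tested fingerprints whose negation
kills the conjunct (a kill criterion shared by all sibling routes), and provable-now ℤ² boundary-arm
benchmarks in slit and corner geometry of the kind CardyCapacityWard (BoundaryWardIdentity: boundary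
two- /three-arm events at marks) and PivotalEnergyLaw (CornerMatching, SideFlatness,
ResponseTightness) also consume.

RANKED CRUXES. #0 AngleDoublingLaw (target) — X = SlitTipTwoArm ∧ CornerTwoArm ∧
CornerQuadraticResponse — the verbatim conjunction of the three crux statements below (tip two-arm
exponent 1/2; corner two-arm exponent 2; quadratic response of the square's crossing probability as
the arc end leaves a convex corner). (why it might fail: False iff bond-ℤ² crossing probabilities
are not conformally covariant at lattice corners / slit tips in the exponent sense (then
CardyFormulaZ2 is false as well); as a proof target nothing beyond the fold dictionary and the
forced benchmarks is in hand.) [CardyNPB1984, Cardy1996, SmirnovWernerMRL2001, Nolin2008]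
#2 SlitTipTwoArm (crux) — (card AD2, wedge angle 2π) Let D_n = {0..2n}² minus the vertex row {(x,n)
: 0 ≤ x < n} (a lattice slit from the left side to the centre, tip vertex t = (n,n)), A = the right
side {x₀ = 2n}, B = the lower lip {(x, n−1) : 0 ≤ x ≤ n}. ΔP_tip(n) := P_(1/2)[B ∪ {t} ↔ A in D_n] −
P_(1/2)[B ↔ A in D_n] is the probability that t is joined to the right side by an open path of D_n
while a closed dual path from the edge {t,(n,n−1)} reaches the bottom / lower-left boundary — the
polychromatic two-arm event AT THE TIP to distance ≍ n (exactly two arms are forced; checked).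
Claim: log ΔP_tip(n) / log n → −1/2. Prediction β₂(2π) = β₂(π)/2 with β₂(π) = 1 universal; the same
increment at a flat boundary point is ≍ 1/n (SideTwoArmBenchmark); the random-walk shadow (harmonic
measure of a slit tip ≍ n^(-1/2)) is Lawler1991 Thm 2.5.2. [difficulty: open-problem] (why it might
fail: No non-universal exponent is proved on ℤ²; the no-switch part of the folded event is
(half-plane one-arm)² ≈ n^(-2/3), so dominant configurations wind around the tip and a proof may
secretly need β₁⁺ = 1/3 (CubeRootBoundaryArm) plus an uncontrolled seam-interlacing gain.)
[CardyNPB1984, SmirnovWernerMRL2001, Nolin2008, WernerPCMI2009, Lawler1991, KestenHitting1987]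
#3 CornerTwoArm (crux) — (card CF, wedge angle π/2, point form) In the square Λ_n = {0..n}²,
ΔP_cor(n) := P_(1/2)[bottom ↔ top in Λ_n] − P_(1/2)[bottom ∖ {(0,0)} ↔ top in Λ_n] (tbCrossing n n
minus the same event with the corner vertex removed from the bottom arc) is the probability that the
corner (0,0) is joined to the top side by an open path (necessarily through (0,1)) while a closed
dual path from the edge {(0,0),(1,0)} reaches the right side — the polychromatic two-arm event AT A
CONVEX CORNER to distance ≍ n. Claim: log ΔP_cor(n) / log n → −2. Prediction β₂(π/2) = 2·β₂(π) = 2;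
the angle-doubling ladder corner : flat : tip = n^(-2) : n^(-1) : n^(-1/2) for the same one-vertex
increment. [difficulty: open-problem] (why it might fail: RSW gives only n^(-1-c) ≲ ΔP_cor ≲ n^(-c')
bounds; the value 2 is pure conformal content (|φ′| ∼ |z−c| at a right angle) and a direct proof
must transfer β₂(π) = 1 through the unfold quadrant = half of a folded half-plane with an exact
factor 2 — known for random walk only.) [CardyEdge1983, CardyNPB1984, Cardy1996, Nolin2008,
GarbanPeteSchramm2010]
#4 CornerQuadraticResponse (crux) — (card CF, macroscopic form — the MC-cheapest fingerprint and the
one with a typed guard) There are c, C, α₀ > 0 such that for every α ∈ (0, α₀], eventually in n: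
c·α² ≤ P_(1/2)[bottom ↔ top in Λ_n] − P_(1/2)[{(x,0) : αn ≤ x ≤ n} ↔ top in Λ_n] ≤ C·α² — moving the
end of the target arc a fraction α of the side away from the convex corner changes the crossing
probability quadratically (C^(1,1)-flatness; at a flat boundary point the response is Lipschitz ≍ α,
at the slit tip Hölder ≍ α^(1/2), at a re-entrant corner ≍ α^(2/3)). Under CardyFormulaZ2 the middle
term tends to F(η(0)) − F(η(α)) ≍ α² (the square's uniformiser is ∼ z² at a corner, F′ > 0): support
CardyForcesCornerResponse. Scale invariance alone allows any power α^γ. [difficulty: open-problem]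
(why it might fail: Two-sided bounds are asked along the full sequence n → ∞ with α-uniform
constants and no LimitExists: if the square's crossing probabilities oscillate in n at order α² the
constants cannot be chosen; and γ = 2 fails iff the ℤ² limit is not conformally covariant at
corners.) [CardyJPhysA1992, CardyNPB1984, LanglandsPouliotSaintaubin1994, GrimmettPercolation1999]
#9 SideTwoArmBenchmark (support) — (forced benchmark, provable now) In the half-box {0..2n} × {0..n}
with A = the top side: c/n ≤ P_(1/2)[{(x,0) : x ≤ n} ↔ A] − P_(1/2)[{(x,0) : x < n} ↔ A] ≤ C/n for n
≥ n₀ — the mark-derivative at the midpoint of a flat side (open arm from (n,0) to the top, closed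
dual arm from the edge {(n−1,0),(n,0)} to the left side) is of exact order 1/n. Bond-ℤ² version of
Werner's exercise "two-arm exponent in the half-plane" (tree, site-𝕋: real_hpGood_le_div,
div_le_real_hpGood); upper bound = telescoping Σ_x ΔP(x) ≤ 1 (the sweep identity that makes β₂(π) =
1 forced) plus comparability of ΔP(x) over the middle window (arm-landing technology, Nolin2008 §4),
lower bound = RSW in two disjoint slabs and "the left-most bottom vertex joined to the top has the
event". [difficulty: M] [WernerPCMI2009, Nolin2008, SmirnovWernerMRL2001,
lean:Literature.Probability.Percolation.rsw_half_holds]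
#9 TipThreeArmForced (support) — (forced AND conformal — the sanity anchor, provable now) With
f_n(m) := P_(1/2)[bottom ↔ top in {0..2n}² minus {(x,n) : x < m}]: c/n ≤ f_n(n) − f_n(n+1) ≤ C/n for
n ≥ n₀ — lengthening the half-length slit by its tip vertex (three arms from the tip: open up, open
down, closed dual to the right side) costs exactly order 1/n. Slit-growth telescoping Σ_m (f_n(m) −
f_n(m+1)) ≤ 1 with translation covariance of the local tip event for m ∈ [n/2, 3n/2] and arm
extension gives the upper bound; RSW gives f_n(n/2) − f_n(3n/2) ≥ c and the lower bound. β₃(2π) = 1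
= β₃(π)/2 is the one lattice angle where a forced value and the conformal prediction meet, and they
agree. [difficulty: L] [KestenSidoraviciusZhang1998, Nolin2008, WernerPCMI2009,
KestenScalingCMP1987]
#9 CardyForcesCornerResponse (support) — (typed refutation guard) CardyFormulaZ2 →
CornerQuadraticResponse: the unit square with marks (α,0), (1,0), (1,1), (0,1) is a conformal
rectangle; G02's discretisation at mesh 1/(n+2) is the square Λ_n with the route's arcs up to O(1)
boundary vertices, each worth o(1) by an RSW arm bound; Cardy gives the limit F(η(0)) − F(η(α));
η(α) − η(0) ≍ α² because the uniformiser of the square is ∼ z² at a corner (Schwarz reflection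
across the two sides, or Weierstrass ℘ of the square lattice), and F′ > 0 on (0,1). Contrapositive:
a refutation of CornerQuadraticResponse refutes the conjunct. (The exponent-level guards
CardyFormulaZ2 → CornerTwoArm / SlitTipTwoArm additionally need quasi-multiplicativity of corner /
tip two-arm events and, for the slit, Carathéodory approximation of the non-Jordan slit domain —
foreseen layer-2 supports, not filed now.) [difficulty: L] [Smirnov2001, CardyJPhysA1992,
BollobasRiordan2006, lean:Literature.Probability.Percolation.CardyFormulaZ2]

TWO-LAYER PLAN. Foreseen glued splits, nothing filed now. SlitTipTwoArm ⇐ TipQuasiMult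
(quasi-multiplicativity / extendability of tip two-arm events between scales; Kesten–Nolin
technology in slit geometry on bond-ℤ²) → TipSeamLaw (the fold engine: in the bilayer half-box glued
along the ray continuing the slit, the seam-alternating two-arm probability is n^(-1/2+o(1)),
attacked by BK–Reimer across layers plus seam arm separation) → SlitTipTwoArm. CornerTwoArm ⇐
CornerQuasiMult → CornerUnfold ((quadrant two-arm)² ≍ n^(o(1)) × (bilayer-quadrant seam-alternating
two-arm = half-plane two-arm ≍ 1/n)) → CornerTwoArm. CornerQuadraticResponse ⇐ CornerTwoArm →
SideTwoArmBenchmark → a scale-k factorisation ΔP(k) ≍ k^(-1)·(k/n)² summed over k ≤ αn →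
CornerQuadraticResponse. Guards: CardyForcesTipExponent, CardyForcesCornerExponent (Cardy plus
quasi-multiplicativity ⇒ the log exponents) as layer-2 supports once CardyForcesCornerResponse
lands.

KILL CRITERIA. (i) Monte-Carlo: successive-doubling exponents of ΔP_tip, ΔP_cor or the α-exponent of
the corner response off the predictions (1/2, 2, 2) by more than 0.15 at n ≥ 64 WHILE the forced
benchmarks (flat two-arm 1, tip three-arm 1) are on target ⇒ attach the evidence file, close the
route refuted:<Decl>, and flag every Cardy route (conformal covariance of bond-ℤ² fails at that
angle); benchmarks off target ⇒ the numerics, not the conjecture, are suspect. (ii) A proof of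
¬CornerQuadraticResponse together with CardyForcesCornerResponse refutes CardyFormulaZ2 itself
(summit-level event; ledger negatives). (iii) If SlitTipTwoArm is shown equivalent to β₁⁺ = 1/3
(CubeRootBoundaryArm of QuarterTurnNoGo), drop it here (route edit --drop SlitTipTwoArm; the corner
items stay). (iv) CardyFormulaZ2 proved by a sibling route moots the cruxes (they become corollaries
through the guards) but not the supports.

NOT DECOMPOSED YET. The fold / bilayer engine statements (TipSeamLaw, CornerUnfold),
quasi-multiplicativity and arm separation in slit / corner geometry on bond-ℤ², the exponent-level
Cardy guards, the Carathéodory / G02 dictionary for the non-Jordan slit domain, the re-entrant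
corner (β₂(3π/2) = 2/3, Hölder-2/3 response at the concave corner of an L-shape) and the bulk
instance on the double cover (five cut-alternating arms around a branch face ≍ n^(-1) from the
universal α₅ = 2 of KestenSidoraviciusZhang1998) — all layer 2, after a crux or the guard closes.
Constants c, C, α₀, n₀ are deliberately left free.

CHEAPEST FALSIFIER. Monte-Carlo of the five typed quantities (script mc/main.py of this planner
folder, submitted as kit compute jobs j000068 (smoke) and the production run noted in NOTES.md;
union–find on {0..2n}², n = 8…128, 10⁴–10⁶ samples each): successive-doubling exponents of ΔP_tip
(target 1/2), ΔP_cor (target 2), ΔP_side (benchmark 1), f_n(n) − f_n(n+1) (benchmark 1) and the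
α-slope of the corner response at the largest n (target 2). Smoke run j000068 (n = 8 → 16 only,
10³-scale samples, 3 s): ΔP_cor local exponent 1.91 (target 2), corner-response α-slope 1.94 between
α = 1/4 and 1/2 at n = 16 (target 2); tip and benchmarks not resolvable at that size. Production
runs (n ≤ 128, 10⁵–10⁶ samples) are submitted with --workitem so their summaries land on the items
as evidence; any refuter can rerun the script in minutes.

NUMBERS. Predictions (wedge law × universal half-plane values, SmirnovWernerMRL2001 Thm 3, Nolin2008
§4.6): β₂(θ) = π/θ and β₃(θ) = 2π/θ, i.e. corner π/2: 2 and 4; flat π: 1 and 2 (theorems on ℤ² up to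
constants for two arms: WernerPCMI2009 exercise sheet; in the tree for site-𝕋 only); re-entrant
3π/2: 2/3 and 4/3; slit 2π: 1/2 and 1; bulk on the k-sheeted cover α_j/k, so α₅ = 2 ⇒ 1 on the
double cover. Macroscopic responses of the crossing probability to moving an arc end a fraction α
from: a flat point ≍ α, a convex corner ≍ α², the slit tip ≍ α^(1/2). Random-walk shadow (proved):
harmonic measure of a slit tip ≍ n^(-1/2) with per-site law s^(-1/2)·n^(-1/2) (Lawler1991
(2.41)–(2.42), Thm 2.5.2). MC: see § Cheapest falsifier (job ids in NOTES.md; numbers attached as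
item evidence).

DEFINITION REQUESTS. None for the filed items (all over `openCrossing` / `rectangle` / `tbCrossing`
/ `HasDecayExponent`). Foreseen at layer 2: a bilayer / seam configuration space with
seam-alternating arm events (topic Summits/CriticalPhenomena/CardyFormulaZ2/Theorems) for the fold
engine, and `domArmEvent`-style wedge / slit arm events for bond-ℤ² (the tree's `domArmEvent` is
site-𝕋).

Novelty: Searches (2026-08-15): lit search --hybrid "percolation wedge corner arm exponent conformal
invariance angle pi/theta boundary" (15 held docs; Cardy1996 p. 198 Ex. 11.4 = the wedge-dimension
law; BollobasRiordan2006, GrimmettPercolation1999 — no wedge or corner exponents for percolation on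
ℤ²); lit galaxy search "percolation in a wedge" --star all (0 rows); lit galaxy search "corner
exponent" --star all (12 rows: Henkel, Conformal Invariance and Critical Phenomena,
panama:516847774466127 — corner exponents in CFT, prediction side; rest off-topic); lit search
--hybrid "Beurling estimate random walk half-line …" (Lawler1991 §2.4–2.5, the proved linear shadow,
materialised pp. 46–47); lit frontier CriticalPhenomena --since 2020 (30 newest descendants, none on
wedge / corner exponents on ℤ²); remote cascades OpenAlex / S2 / arXiv rate-limited today (HTTP
429), zbMATH "percolation wedge exponent" 5 irrelevant rows; ledger negatives --problem
CriticalPhenomena (1 refuted statement, SAW, unrelated); all 22 Theses of the sub-problem read: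
QuarterTurnNoGo carries the half-plane ONE-arm exponent statements (β₁⁺ < 1/2, β₁⁺ = 1/3) and the
guard pattern CardyForcesCubeRoot; PivotalEnergyLaw carries CornerMatching / SideFlatness (three-arm
push responses of rectangles, continuity across a right angle, no exponent); CardyCapacityWard uses
boundary two- /three-arm events at FLAT marks; card squaring-covariance-cone-graph uses the cone
graph for z² as a route to full CI; no route or card state  [refs: Cardy1996, BollobasRiordan2006, GrimmettPercolation1999, Lawler1991, CardyEdge1983, CardyNPB1984, SmirnovWernerMRL2001, Smirnov2001, Nolin2008, WernerPCMI2009]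

Barriers (technique_class: arm-exponents, lattice-folding, corner-asymptotics): - technique_class: arm-exponents, lattice-folding, corner-asymptotics
- Literature.Barriers.CriticalPhenomena.EmbeddingModulusUniqueness: evaded and used diagnostically —
every item refers to the Euclidean angles π/2 and 2π of the SQUARE embedding (fold along a lattice
axis); under Beffara's shear the same combinatorial events sit at other angles of the sheared
conformal structure and the predicted numbers change, so no embedding-blind argument can prove the
cruxes: any proof must use the D₄ symmetry / self-duality of ℤ² at p = 1/2, which the fold does
(reflection in an axis is a lattice automorphism commuting with duality).
- Literature.Barriers.CriticalPhenomena.ScaleCovarianceNotMoebius: not in its class (no upgrade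
scale ⇒ conformal is attempted); the route is the lattice-exponent shadow of that barrier's moral —
it isolates the numbers that only conformal covariance predicts and tests them.
- Literature.Barriers.CriticalPhenomena.SmirnovTriangularOnly: not in class (no discrete-holomorphic
observable, no colour switching); the forced supports use only RSW, duality and BK–Reimer, which
hold on ℤ².
- Literature.Barriers.CriticalPhenomena.CoveringLatticeShift: not in class (no site rewriting of
bond-ℤ², no shift cancellation).
- Negatives index: one refuted statement (stmt-CriticalPhenomena-0772, SAW parafermionic tightness)
— unrelated; no arm-exponent statement of this summit has been refuted.

History (route lifecycle, newest last):
- 2026-08-15T13:47:44Z · CLOSED retired — not-a-thesis: assembly does not conclude the sub-problem Statement (operator:999:1257524)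

sub-problem: CardyFormulaZ2 · status: closed(retired) · opened planner-plancard-CriticalPhenomena-CardyFormu-85feb3c9-0 2026-08-15T12:13:19Z · rev 0 · ledger route-CriticalPhenomena-AngleDoublingExponents
GENERATED by the gate from the ledger (D-0016/17). Provers cite these decls: `theorem foo : Summit.CriticalPhenomena.CardyFormulaZ2.Theses.AngleDoublingExponents.<Decl> := …` in Summits/CriticalPhenomena/CardyFormulaZ2/Theorems/<Name>.lean.
-/

namespace Summit.CriticalPhenomena.CardyFormulaZ2.Theses.AngleDoublingExponents

open scoped BigOperators Topology Manifold Classical MeasureTheory ProbabilityTheory Matrix InnerProductSpace ComplexConjugate ContinuousMap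
open Filter Set Function TopologicalSpace MeasureTheory

attribute [summit_statement] _root_.CardyFormulaZ2

/-- item stmt-CriticalPhenomena-7638 · target · rank 0 · closed · moot by None · by planner
why it might fail: False iff bond-ℤ² crossing probabilities are not conformally covariant at lattice corners / slit tips in the exponent sense (then CardyFormulaZ2 is false as well); as a proof target nothing beyond the fold dictionary and the forced benchmarks is in hand.
sources: CardyNPB1984, Cardy1996, SmirnovWernerMRL2001, Nolin2008
[target] X = SlitTipTwoArm ∧ CornerTwoArm ∧ CornerQuadraticResponse — the verbatim conjunction of
the three crux statements below (tip two-arm exponent 1/2; corner two-arm exponent 2; quadratic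
response of the square's crossing probability as the arc end leaves a convex corner). -/
@[route_item "route-CriticalPhenomena-AngleDoublingExponents"]
def AngleDoublingLaw : Prop :=
  Literature.Probability.LatticeModels.HasDecayExponent (fun n : ℕ => (Literature.Probability.Percolation.bondPercolation (Literature.Probability.LatticeModels.zdGraph 2) Literature.Probability.Percolation.half).real (Literature.Probability.Percolation.openCrossing {x : Literature.Probability.LatticeModels.Site 2 | x ∈ Literature.Probability.Percolation.rectangle (2 * n) (2 * n) ∧ ¬ (x 1 = n ∧ x 0 < n)} {x | (x 1 = (n : ℤ) - 1 ∧ 0 ≤ x 0 ∧ x 0 ≤ n) ∨ x = ![(n : ℤ), n]} ↑(Literature.Probability.Percolation.rightSide (2 * n) (2 * n))) - (Literature.Probability.Percolation.bondPercolation (Literature.Probability.LatticeModels.zdGraph 2) Literature.Probability.Percolation.half).real (Literature.Probability.Percolation.openCrossing {x : Literature.Probability.LatticeModels.Site 2 | x ∈ Literature.Probability.Percolation.rectangle (2 * n) (2 * n) ∧ ¬ (x 1 = n ∧ x 0 < n)} {x | x 1 = (n : ℤ) - 1 ∧ 0 ≤ x 0 ∧ x 0 ≤ n} ↑(Literature.Probability.Percolation.rightSide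 (2 * n) (2 * n)))) (1 / 2) ∧ Literature.Probability.LatticeModels.HasDecayExponent (fun n : ℕ => (Literature.Probability.Percolation.bondPercolation (Literature.Probability.LatticeModels.zdGraph 2) Literature.Probability.Percolation.half).real (Literature.Probability.Percolation.tbCrossing n n) - (Literature.Probability.Percolation.bondPercolation (Literature.Probability.LatticeModels.zdGraph 2) Literature.Probability.Percolation.half).real (Literature.Probability.Percolation.openCrossing ↑(Literature.Probability.Percolation.rectangle n n) {x : Literature.Probability.LatticeModels.Site 2 | x 1 = 0 ∧ 1 ≤ x 0 ∧ x 0 ≤ n} ↑(Literature.Probability.Percolation.topSide n n))) 2 ∧ (∃ c C α₀ : ℝ, 0 < c ∧ 0 < α₀ ∧ ∀ α : ℝ, 0 < α → α ≤ α₀ → ∀ᶠ n : ℕ in Filter.atTop, c * α ^ 2 ≤ (Literature.Probability.Percolation.bondPercolation (Literature.Probability.LatticeModels.zdGraph 2) Literature.Probability.Percolation.half).real (Literature.Probability.Percolation.tbCrossing n n) - (Literature.Probability.Percolation.bondPercolation (Literature.Probability.LatticeModels.zdGraph 2) Literature.Probability.Percolation.half).real (Literature.Probability.Percolation.openCrossing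 ↑(Literature.Probability.Percolation.rectangle n n) {x : Literature.Probability.LatticeModels.Site 2 | x 1 = 0 ∧ α * n ≤ ((x 0 : ℤ) : ℝ) ∧ x 0 ≤ n} ↑(Literature.Probability.Percolation.topSide n n)) ∧ (Literature.Probability.Percolation.bondPercolation (Literature.Probability.LatticeModels.zdGraph 2) Literature.Probability.Percolation.half).real (Literature.Probability.Percolation.tbCrossing n n) - (Literature.Probability.Percolation.bondPercolation (Literature.Probability.LatticeModels.zdGraph 2) Literature.Probability.Percolation.half).real (Literature.Probability.Percolation.openCrossing ↑(Literature.Probability.Percolation.rectangle n n) {x : Literature.Probability.LatticeModels.Site 2 | x 1 = 0 ∧ α * n ≤ ((x 0 : ℤ) : ℝ) ∧ x 0 ≤ n} ↑(Literature.Probability.Percolation.topSide n n)) ≤ C * α ^ 2)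

/-- item stmt-CriticalPhenomena-7639 · crux · rank 2 · closed · moot by None · by planner
why it might fail: No non-universal exponent is proved on ℤ²; the no-switch part of the folded event is (half-plane one-arm)² ≈ n^(-2/3), so dominant configurations wind around the tip and a proof may secretly need β₁⁺ = 1/3 (CubeRootBoundaryArm) plus an uncontrolled seam-interlacing gain.
sources: CardyNPB1984, SmirnovWernerMRL2001, Nolin2008, WernerPCMI2009, Lawler1991, KestenHitting1987
[crux] (card AD2, wedge angle 2π) Let D_n = {0..2n}² minus the vertex row {(x,n) : 0 ≤ x < n} (a
lattice slit from the left side to the centre, tip vertex t = (n,n)), A = the right side {x₀ = 2n},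
B = the lower lip {(x, n−1) : 0 ≤ x ≤ n}. ΔP_tip(n) := P_(1/2)[B ∪ {t} ↔ A in D_n] − P_(1/2)[B ↔ A
in D_n] is the probability that t is joined to the right side by an open path of D_n while a closed
dual path from the edge {t,(n,n−1)} reaches the bottom / lower-left boundary — the polychromatic
two-arm event AT THE TIP to distance ≍ n (exactly two arms are forced; checked). Claim: log
ΔP_tip(n) / log n → −1/2. Prediction β₂(2π) = β₂(π)/2 with β₂(π) = 1 universal; the same increment
at a flat boundary point is ≍ 1/n (SideTwoArmBenchmark); the random-walk shadow (harmonic measure of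
a slit tip ≍ n^(-1/2)) is Lawler1991 Thm 2.5.2. [difficulty: open-problem] -/
@[route_item "route-CriticalPhenomena-AngleDoublingExponents"]
def SlitTipTwoArm : Prop :=
  Literature.Probability.LatticeModels.HasDecayExponent (fun n : ℕ => (Literature.Probability.Percolation.bondPercolation (Literature.Probability.LatticeModels.zdGraph 2) Literature.Probability.Percolation.half).real (Literature.Probability.Percolation.openCrossing {x : Literature.Probability.LatticeModels.Site 2 | x ∈ Literature.Probability.Percolation.rectangle (2 * n) (2 * n) ∧ ¬ (x 1 = n ∧ x 0 < n)} {x | (x 1 = (n : ℤ) - 1 ∧ 0 ≤ x 0 ∧ x 0 ≤ n) ∨ x = ![(n : ℤ), n]} ↑(Literature.Probability.Percolation.rightSide (2 * n) (2 * n))) - (Literature.Probability.Percolation.bondPercolation (Literature.Probability.LatticeModels.zdGraph 2) Literature.Probability.Percolation.half).real (Literature.Probability.Percolation.openCrossing {x : Literature.Probability.LatticeModels.Site 2 | x ∈ Literature.Probability.Percolation.rectangle (2 * n) (2 * n) ∧ ¬ (x 1 = n ∧ x 0 < n)} {x | x 1 = (n : ℤ) - 1 ∧ 0 ≤ x 0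 ∧ x 0 ≤ n} ↑(Literature.Probability.Percolation.rightSide (2 * n) (2 * n)))) (1 / 2)

/-- item stmt-CriticalPhenomena-7640 · crux · rank 3 · closed · moot by None · by planner
why it might fail: RSW gives only n^(-1-c) ≲ ΔP_cor ≲ n^(-c') bounds; the value 2 is pure conformal content (|φ′| ∼ |z−c| at a right angle) and a direct proof must transfer β₂(π) = 1 through the unfold quadrant = half of a folded half-plane with an exact factor 2 — known for random walk only.
sources: CardyEdge1983, CardyNPB1984, Cardy1996, Nolin2008, GarbanPeteSchramm2010
[crux] (card CF, wedge angle π/2, point form) In the square Λ_n = {0..n}², ΔP_cor(n) :=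
P_(1/2)[bottom ↔ top in Λ_n] − P_(1/2)[bottom ∖ {(0,0)} ↔ top in Λ_n] (tbCrossing n n minus the same
event with the corner vertex removed from the bottom arc) is the probability that the corner (0,0)
is joined to the top side by an open path (necessarily through (0,1)) while a closed dual path from
the edge {(0,0),(1,0)} reaches the right side — the polychromatic two-arm event AT A CONVEX CORNER
to distance ≍ n. Claim: log ΔP_cor(n) / log n → −2. Prediction β₂(π/2) = 2·β₂(π) = 2; the
angle-doubling ladder corner : flat : tip = n^(-2) : n^(-1) : n^(-1/2) for the same one-vertex
increment. [difficulty: open-problem] -/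
@[route_item "route-CriticalPhenomena-AngleDoublingExponents"]
def CornerTwoArm : Prop :=
  Literature.Probability.LatticeModels.HasDecayExponent (fun n : ℕ => (Literature.Probability.Percolation.bondPercolation (Literature.Probability.LatticeModels.zdGraph 2) Literature.Probability.Percolation.half).real (Literature.Probability.Percolation.tbCrossing n n) - (Literature.Probability.Percolation.bondPercolation (Literature.Probability.LatticeModels.zdGraph 2) Literature.Probability.Percolation.half).real (Literature.Probability.Percolation.openCrossing ↑(Literature.Probability.Percolation.rectangle n n) {x : Literature.Probability.LatticeModels.Site 2 | x 1 = 0 ∧ 1 ≤ x 0 ∧ x 0 ≤ n} ↑(Literature.Probability.Percolation.topSide n n))) 2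

/-- item stmt-CriticalPhenomena-7641 · crux · rank 4 · closed · moot by None · by planner
why it might fail: Two-sided bounds are asked along the full sequence n → ∞ with α-uniform constants and no LimitExists: if the square's crossing probabilities oscillate in n at order α² the constants cannot be chosen; and γ = 2 fails iff the ℤ² limit is not conformally covariant at corners.
sources: CardyJPhysA1992, CardyNPB1984, LanglandsPouliotSaintaubin1994, GrimmettPercolation1999
[crux] (card CF, macroscopic form — the MC-cheapest fingerprint and the one with a typed guard)
There are c, C, α₀ > 0 such that for every α ∈ (0, α₀], eventually in n: c·α² ≤ P_(1/2)[bottom ↔ top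
in Λ_n] − P_(1/2)[{(x,0) : αn ≤ x ≤ n} ↔ top in Λ_n] ≤ C·α² — moving the end of the target arc a
fraction α of the side away from the convex corner changes the crossing probability quadratically
(C^(1,1)-flatness; at a flat boundary point the response is Lipschitz ≍ α, at the slit tip Hölder ≍
α^(1/2), at a re-entrant corner ≍ α^(2/3)). Under CardyFormulaZ2 the middle term tends to F(η(0)) −
F(η(α)) ≍ α² (the square's uniformiser is ∼ z² at a corner, F′ > 0): support
CardyForcesCornerResponse. Scale invariance alone allows any power α^γ. [difficulty: open-problem] -/
@[route_item "route-CriticalPhenomena-AngleDoublingExponents"]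
def CornerQuadraticResponse : Prop :=
  ∃ c C α₀ : ℝ, 0 < c ∧ 0 < α₀ ∧ ∀ α : ℝ, 0 < α → α ≤ α₀ → ∀ᶠ n : ℕ in Filter.atTop, c * α ^ 2 ≤ (Literature.Probability.Percolation.bondPercolation (Literature.Probability.LatticeModels.zdGraph 2) Literature.Probability.Percolation.half).real (Literature.Probability.Percolation.tbCrossing n n) - (Literature.Probability.Percolation.bondPercolation (Literature.Probability.LatticeModels.zdGraph 2) Literature.Probability.Percolation.half).real (Literature.Probability.Percolation.openCrossing ↑(Literature.Probability.Percolation.rectangle n n) {x : Literature.Probability.LatticeModels.Site 2 | x 1 = 0 ∧ α * n ≤ ((x 0 : ℤ) : ℝ) ∧ x 0 ≤ n} ↑(Literature.Probability.Percolation.topSide n n)) ∧ (Literature.Probability.Percolation.bondPercolation (Literature.Probability.LatticeModels.zdGraph 2) Literature.Probability.Percolation.half).real (Literature.Probability.Percolation.tbCrossing n n) - (Literature.Probability.Percolation.bondPercolation (Literature.Probability.LatticeModels.zdGraph 2) Literature.Probability.Percolation.half).real (Literature.Probability.Percolation.openCrossing ↑(Literature.Probability.Percolation.rectangle n n) {x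 : Literature.Probability.LatticeModels.Site 2 | x 1 = 0 ∧ α * n ≤ ((x 0 : ℤ) : ℝ) ∧ x 0 ≤ n} ↑(Literature.Probability.Percolation.topSide n n)) ≤ C * α ^ 2

/-- item stmt-CriticalPhenomena-7642 · support · rank 9 · closed · moot by None · by planner
sources: WernerPCMI2009, Nolin2008, SmirnovWernerMRL2001, lean:Literature.Probability.Percolation.rsw_half_holds
[support] (forced benchmark, provable now) In the half-box {0..2n} × {0..n} with A = the top side:
c/n ≤ P_(1/2)[{(x,0) : x ≤ n} ↔ A] − P_(1/2)[{(x,0) : x < n} ↔ A] ≤ C/n for n ≥ n₀ — the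
mark-derivative at the midpoint of a flat side (open arm from (n,0) to the top, closed dual arm from
the edge {(n−1,0),(n,0)} to the left side) is of exact order 1/n. Bond-ℤ² version of Werner's
exercise "two-arm exponent in the half-plane" (tree, site-𝕋: real_hpGood_le_div,
div_le_real_hpGood); upper bound = telescoping Σ_x ΔP(x) ≤ 1 (the sweep identity that makes β₂(π) =
1 forced) plus comparability of ΔP(x) over the middle window (arm-landing technology, Nolin2008 §4),
lower bound = RSW in two disjoint slabs and "the left-most bottom vertex joined to the top has the
event". [difficulty: M] -/
@[route_item "route-CriticalPhenomena-AngleDoublingExponents"]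
def SideTwoArmBenchmark : Prop :=
  ∃ c C : ℝ, 0 < c ∧ ∃ n₀ : ℕ, ∀ n : ℕ, n₀ ≤ n → c / n ≤ (Literature.Probability.Percolation.bondPercolation (Literature.Probability.LatticeModels.zdGraph 2) Literature.Probability.Percolation.half).real (Literature.Probability.Percolation.openCrossing ↑(Literature.Probability.Percolation.rectangle (2 * n) n) {x : Literature.Probability.LatticeModels.Site 2 | x 1 = 0 ∧ 0 ≤ x 0 ∧ x 0 ≤ n} ↑(Literature.Probability.Percolation.topSide (2 * n) n)) - (Literature.Probability.Percolation.bondPercolation (Literature.Probability.LatticeModels.zdGraph 2) Literature.Probability.Percolation.half).real (Literature.Probability.Percolation.openCrossing ↑(Literature.Probability.Percolation.rectangle (2 * n) n) {x : Literature.Probability.LatticeModels.Site 2 | x 1 = 0 ∧ 0 ≤ x 0 ∧ x 0 < n} ↑(Literature.Probability.Percolation.topSide (2 * n) n)) ∧ (Literature.Probability.Percolation.bondPercolation (Literature.Probability.LatticeModels.zdGraph 2) Literature.Probability.Percolation.half).real (Literature.Probability.Percolation.openCrossing ↑(Literature.Probability.Percolation.rectangle (2 * n) n) {x : Literature.Probability.LatticeModels.Site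 2 | x 1 = 0 ∧ 0 ≤ x 0 ∧ x 0 ≤ n} ↑(Literature.Probability.Percolation.topSide (2 * n) n)) - (Literature.Probability.Percolation.bondPercolation (Literature.Probability.LatticeModels.zdGraph 2) Literature.Probability.Percolation.half).real (Literature.Probability.Percolation.openCrossing ↑(Literature.Probability.Percolation.rectangle (2 * n) n) {x : Literature.Probability.LatticeModels.Site 2 | x 1 = 0 ∧ 0 ≤ x 0 ∧ x 0 < n} ↑(Literature.Probability.Percolation.topSide (2 * n) n)) ≤ C / n

/-- item stmt-CriticalPhenomena-7643 · support · rank 9 · closed · moot by None · by planner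
sources: KestenSidoraviciusZhang1998, Nolin2008, WernerPCMI2009, KestenScalingCMP1987
[support] (forced AND conformal — the sanity anchor, provable now) With f_n(m) := P_(1/2)[bottom ↔
top in {0..2n}² minus {(x,n) : x < m}]: c/n ≤ f_n(n) − f_n(n+1) ≤ C/n for n ≥ n₀ — lengthening the
half-length slit by its tip vertex (three arms from the tip: open up, open down, closed dual to the
right side) costs exactly order 1/n. Slit-growth telescoping Σ_m (f_n(m) − f_n(m+1)) ≤ 1 with
translation covariance of the local tip event for m ∈ [n/2, 3n/2] and arm extension gives the upper
bound; RSW gives f_n(n/2) − f_n(3n/2) ≥ c and the lower bound. β₃(2π) = 1 = β₃(π)/2 is the one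
lattice angle where a forced value and the conformal prediction meet, and they agree. [difficulty:
L] -/
@[route_item "route-CriticalPhenomena-AngleDoublingExponents"]
def TipThreeArmForced : Prop :=
  ∃ c C : ℝ, 0 < c ∧ ∃ n₀ : ℕ, ∀ n : ℕ, n₀ ≤ n → c / n ≤ (Literature.Probability.Percolation.bondPercolation (Literature.Probability.LatticeModels.zdGraph 2) Literature.Probability.Percolation.half).real (Literature.Probability.Percolation.openCrossing {x : Literature.Probability.LatticeModels.Site 2 | x ∈ Literature.Probability.Percolation.rectangle (2 * n) (2 * n) ∧ ¬ (x 1 = n ∧ x 0 < n)} ↑(Literature.Probability.Percolation.bottomSide (2 * n) (2 * n)) ↑(Literature.Probability.Percolation.topSide (2 * n) (2 * n))) - (Literature.Probability.Percolation.bondPercolation (Literature.Probability.LatticeModels.zdGraph 2) Literature.Probability.Percolation.half).real (Literature.Probability.Percolation.openCrossing {x : Literature.Probability.LatticeModels.Site 2 | x ∈ Literature.Probability.Percolation.rectangle (2 * n) (2 * n) ∧ ¬ (x 1 = n ∧ x 0 ≤ n)} ↑(Literature.Probability.Percolation.bottomSide (2 * n) (2 * n)) ↑(Literature.Probability.Percolation.topSide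 (2 * n) (2 * n))) ∧ (Literature.Probability.Percolation.bondPercolation (Literature.Probability.LatticeModels.zdGraph 2) Literature.Probability.Percolation.half).real (Literature.Probability.Percolation.openCrossing {x : Literature.Probability.LatticeModels.Site 2 | x ∈ Literature.Probability.Percolation.rectangle (2 * n) (2 * n) ∧ ¬ (x 1 = n ∧ x 0 < n)} ↑(Literature.Probability.Percolation.bottomSide (2 * n) (2 * n)) ↑(Literature.Probability.Percolation.topSide (2 * n) (2 * n))) - (Literature.Probability.Percolation.bondPercolation (Literature.Probability.LatticeModels.zdGraph 2) Literature.Probability.Percolation.half).real (Literature.Probability.Percolation.openCrossing {x : Literature.Probability.LatticeModels.Site 2 | x ∈ Literature.Probability.Percolation.rectangle (2 * n) (2 * n) ∧ ¬ (x 1 = n ∧ x 0 ≤ n)} ↑(Literature.Probability.Percolation.bottomSide (2 * n) (2 * n)) ↑(Literature.Probability.Percolation.topSide (2 * n) (2 * n))) ≤ C / n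

/-- item stmt-CriticalPhenomena-7644 · support · rank 9 · closed · moot by None · by planner
sources: Smirnov2001, CardyJPhysA1992, BollobasRiordan2006, lean:Literature.Probability.Percolation.CardyFormulaZ2
[support] (typed refutation guard) CardyFormulaZ2 → CornerQuadraticResponse: the unit square with
marks (α,0), (1,0), (1,1), (0,1) is a conformal rectangle; G02's discretisation at mesh 1/(n+2) is
the square Λ_n with the route's arcs up to O(1) boundary vertices, each worth o(1) by an RSW arm
bound; Cardy gives the limit F(η(0)) − F(η(α)); η(α) − η(0) ≍ α² because the uniformiser of the
square is ∼ z² at a corner (Schwarz reflection across the two sides, or Weierstrass ℘ of the square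
lattice), and F′ > 0 on (0,1). Contrapositive: a refutation of CornerQuadraticResponse refutes the
conjunct. (The exponent-level guards CardyFormulaZ2 → CornerTwoArm / SlitTipTwoArm additionally need
quasi-multiplicativity of corner / tip two-arm events and, for the slit, Carathéodory approximation
of the non-Jordan slit domain — foreseen layer-2 supports, not filed now.) [difficulty: L] -/
@[route_item "route-CriticalPhenomena-AngleDoublingExponents"]
def CardyForcesCornerResponse : Prop :=
  CardyFormulaZ2 → (∃ c C α₀ : ℝ, 0 < c ∧ 0 < α₀ ∧ ∀ α : ℝ, 0 < α → α ≤ α₀ → ∀ᶠ n : ℕ in Filter.atTop, c * α ^ 2 ≤ (Literature.Probability.Percolation.bondPercolation (Literature.Probability.LatticeModels.zdGraph 2) Literature.Probability.Percolation.half).real (Literature.Probability.Percolation.tbCrossing n n) - (Literature.Probability.Percolation.bondPercolation (Literature.Probability.LatticeModels.zdGraph 2) Literature.Probability.Percolation.half).real (Literature.Probability.Percolation.openCrossing ↑(Literature.Probability.Percolation.rectangle n n) {x : Literature.Probability.LatticeModels.Site 2 | x 1 = 0 ∧ α * n ≤ ((x 0 : ℤ) : ℝ) ∧ x 0 ≤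 n} ↑(Literature.Probability.Percolation.topSide n n)) ∧ (Literature.Probability.Percolation.bondPercolation (Literature.Probability.LatticeModels.zdGraph 2) Literature.Probability.Percolation.half).real (Literature.Probability.Percolation.tbCrossing n n) - (Literature.Probability.Percolation.bondPercolation (Literature.Probability.LatticeModels.zdGraph 2) Literature.Probability.Percolation.half).real (Literature.Probability.Percolation.openCrossing ↑(Literature.Probability.Percolation.rectangle n n) {x : Literature.Probability.LatticeModels.Site 2 | x 1 = 0 ∧ α * n ≤ ((x 0 : ℤ) : ℝ) ∧ x 0 ≤ n} ↑(Literature.Probability.Percolation.topSide n n)) ≤ C * α ^ 2)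

/-- item stmt-CriticalPhenomena-7645 · assembly · rank 1 · closed · moot by None · by planner
sources: CardyNPB1984
[assembly] SlitTipTwoArm → CornerTwoArm → CornerQuadraticResponse → AngleDoublingLaw (the target is
literally their conjunction). -/
@[route_item "route-CriticalPhenomena-AngleDoublingExponents"]
def Assembly : Prop :=
  SlitTipTwoArm → CornerTwoArm → CornerQuadraticResponse → AngleDoublingLaw

end Summit.CriticalPhenomena.CardyFormulaZ2.Theses.AngleDoublingExponents
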